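import Literature.Probability.Percolation.BoundaryExplorer
import HarnessLib

/-!
# The boundary-interface exploration examines every pivotal block (planar part)

Topic `Literature/Probability/Percolation`; support file for the named fact
`Literature.Probability.Percolation.Garban2011_fourArm_multiscale` (`FourArmGarban.lean`;
C. Garban, Appendix B of O. Schramm, S. Smirnov, Ann. Probab. 39 (2011), Lemma B.1), in the
variant of J. van den Berg, P. Nolin, Progr. Probab. 77 (2020), §5.2, whose single deterministic
input about the exploration `Γ` is: "if `ω ∈ {v_j is pivotal}`, the state of `v_j` must be
explored by `Γ`". For blocks of bond percolation on `ℤ²` this reads: if two distinct open clusters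
of the box `B(M)` meeting the sphere `‖·‖_∞ = M` both touch a block `V = j + B(ρ)`, then the
boundary-interface explorer (`BoundaryExplorer.lean`) examines an edge of `V`. This file PROVES
the contrapositive, `boxOpenGraph_reachable_of_forall_not_mem`: **if no lattice edge with both
endpoints in `V` has been examined when the explorer stops, then any two sites of `V` that are
joined to the sphere by open paths of `B(M)` are joined to each other.**

The proof is planar but uses no Jordan curve theorem; it runs on the terminal data of the
exploration (`X` the examined edges, `𝒪 = OReach`, `𝒟 = DReach`, no eligible edge left):
* the faces not in `𝒟` split into components (`faceComp`) under adjacency across lattice edges;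
  a lattice edge *separating* a component `W` from its complement has its other face in `𝒟`, and
  is either examined, open, with both endpoints in `𝒪` ("type α") or unexamined with no endpoint
  in `𝒪` ("type β") (`IsTerminal.type_dichotomy`, from termination);
* **uniformity** (`sep_uniform`): if one separating edge of `W` is examined then all are — by the
  parity lemma `mem_of_parity` (`LatticeFaceParity.lean`) applied to the even, all-or-nothing set
  of examined separating edges (type α propagates around a vertex of `𝒪`; `𝒟`-faces and outer
  faces escape upwards without crossing examined-open edges);
* **invariant along open paths from the sphere** (`inv_of_walk`): every site is in `𝒪` or is
  *pure* (all four faces cornered at it) inside a uniform component;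
* whence, for the component `W₀` of the inner faces of the untouched block `V`, both clusters
  carry a vertex on a separating edge of `W₀`, `W₀` is uniform, and a second application of
  `mem_of_parity` to the separating edges reachable from `x` shows that they exhaust the
  separating edges, joining `x` to `y`.

## References

* J. van den Berg, P. Nolin, Progr. Probab. 77 (2020) = arXiv:2008.01606, §5.2 ("if
  `ω ∈ {v_j is pivotal}`, the state of `v_j` must be explored by `Γ`") [VandenbergNolin2020].
* O. Schramm, S. Smirnov (appendix by C. Garban), Ann. Probab. 39 (2011), Appendix B, proof of
  Lemma B.1 ("if `Q_j` is pivotal for `X`, then [...] the interface `γ` [has] to intersect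
  `Q_j`") [SchrammSmirnov2011].

Tree: `boundaryExplorer`, `OReach`, `DReach`, `Eligible`, `boxLatticeEdges`, `IsInnerFace`,
`reflTransGen_of_imp` (`BoundaryExplorer.lean`), `IsFaceOf`, `TouchesFace`, `SeparatesFaces`,
`exists_edge_of_touchesFace`, `touchesFace_of_isFaceOf`, `even_degree_of_allOrNothing`,
`mem_of_parity`, `exists_dualEdge_eq_mk`, `dualEdge_single_eq` (`LatticeFaceParity.lean`),
`boxOpenGraph`, `boxOpenGraph_adj` (`CrossingClusterCount.lean`).
-/

noncomputable section

namespace Literature.Probability.Percolation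

open LatticeModels Relation SimpleGraph
open scoped Classical

/-! ### Face paths: lines, rectangles, escape of outer faces -/

/-- The lattice edge whose two faces are `a` and `a + eᵢ`. [folklore] -/
theorem dualEdge_mk_add_single (a : Site 2) (i : Fin 2) :
    dualEdge s(a + Pi.single i 1, a + Pi.single i 1 + Pi.single (i + 1) 1) = s(a, a + Pi.single i 1) := by
  have h : (i + 1 : Fin 2) ≠ i := (fin_two_ne_add_one i).symm
  rw [dualEdge_single_eq h, add_sub_cancel_right]

/-- **Straight face paths.** If `P` holds at the faces `f + k eᵢ`, `0 ≤ k ≤ n`, then `f` and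
`f + n eᵢ` are joined by a path of lattice-adjacent faces inside `P`. [folklore] -/
theorem reflTransGen_line (P : Site 2 → Prop) (f : Site 2) (i : Fin 2) (n : ℕ)
    (h : ∀ k : ℕ, k ≤ n → P (f + Pi.single i (k : ℤ))) :
    ReflTransGen (fun a b => P a ∧ P b ∧ ∃ e ∈ (zdGraph 2).edgeSet, dualEdge e = s(a, b))
      f (f + Pi.single i (n : ℤ)) := by
  induction n with
  | zero => simp only [Nat.cast_zero, Pi.single_zero, add_zero]; exact ReflTransGen.refl
  | succ n ih =>
    have hstep : f + Pi.single i ((n : ℤ) + 1) = f + Pi.single i (n : ℤ) + Pi.single i 1 := by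
      rw [add_assoc, ← Pi.single_add]
    refine (ih fun k hk => h k (Nat.le_succ_of_le hk)).tail ⟨?_, ?_, ?_⟩
    · exact_mod_cast h n (Nat.le_succ n)
    · exact_mod_cast h (n + 1) le_rfl
    · refine ⟨_, single_edge_mem (f + Pi.single i (n : ℤ) + Pi.single i 1) (i + 1), ?_⟩
      push_cast
      rw [hstep]
      exact dualEdge_mk_add_single _ _

/-- Reversal of a `ReflTransGen` path of a symmetric relation (explicit form). [folklore] -/
theorem reflTransGen_reverse {α : Type*} {r : α → α → Prop} (hr : ∀ a b, r a b → r b a) {a b : α}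
    (h : ReflTransGen r a b) : ReflTransGen r b a := by
  induction h with
  | refl => exact ReflTransGen.refl
  | tail _ hbc ih => exact ReflTransGen.head (hr _ _ hbc) ih

/-- The adjacency relation on faces inside `P` is symmetric. [folklore] -/
theorem faceAdj_symm (P : Site 2 → Prop) (a b : Site 2)
    (h : P a ∧ P b ∧ ∃ e ∈ (zdGraph 2).edgeSet, dualEdge e = s(a, b)) :
    P b ∧ P a ∧ ∃ e ∈ (zdGraph 2).edgeSet, dualEdge e = s(b, a) := by
  obtain ⟨ha, hb, e, he, hd⟩ := h
  exact ⟨hb, ha, e, he, by rw [hd, Sym2.eq_swap]⟩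

/-- The `S`-free adjacency relation on faces is symmetric. [folklore] -/
theorem freeAdj_symm (S : Finset (Sym2 (Site 2))) (a b : Site 2)
    (h : ∃ e ∈ (zdGraph 2).edgeSet, e ∉ S ∧ dualEdge e = s(a, b)) :
    ∃ e ∈ (zdGraph 2).edgeSet, e ∉ S ∧ dualEdge e = s(b, a) := by
  obtain ⟨e, he, heS, hd⟩ := h
  exact ⟨e, he, heS, by rw [hd, Sym2.eq_swap]⟩

/-- **Rectangles of faces are connected**: if `P` holds on the discrete rectangle
`{g | lo ≤ g ≤ hi}` (coordinatewise), any two faces of the rectangle are joined by a path of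
lattice-adjacent faces inside `P`. [folklore] -/
theorem reflTransGen_of_mem_rect (P : Site 2 → Prop) (lo hi : Site 2)
    (hP : ∀ g : Site 2, (∀ i, lo i ≤ g i ∧ g i ≤ hi i) → P g) {f f' : Site 2}
    (hf : ∀ i, lo i ≤ f i ∧ f i ≤ hi i) (hf' : ∀ i, lo i ≤ f' i ∧ f' i ≤ hi i) :
    ReflTransGen (fun a b => P a ∧ P b ∧ ∃ e ∈ (zdGraph 2).edgeSet, dualEdge e = s(a, b)) f f' := by
  -- join `lo` to any face `g` of the rectangle: right by `g 0 - lo 0`, then up by `g 1 - lo 1`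
  have key : ∀ g : Site 2, (∀ i, lo i ≤ g i ∧ g i ≤ hi i) →
      ReflTransGen (fun a b => P a ∧ P b ∧ ∃ e ∈ (zdGraph 2).edgeSet, dualEdge e = s(a, b)) lo g := by
    intro g hg
    set m : ℕ := (g 0 - lo 0).toNat with hm
    set n : ℕ := (g 1 - lo 1).toNat with hn
    have hm' : (m : ℤ) = g 0 - lo 0 := by rw [hm, Int.toNat_of_nonneg (by have := hg 0; omega)]
    have hn' : (n : ℤ) = g 1 - lo 1 := by rw [hn, Int.toNat_of_nonneg (by have := hg 1; omega)]
    have hmid : lo + Pi.single 0 (m : ℤ) + Pi.single 1 (n : ℤ) = g := by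
      funext t; fin_cases t <;> simp [hm', hn']
    have h1 : ReflTransGen (fun a b => P a ∧ P b ∧ ∃ e ∈ (zdGraph 2).edgeSet, dualEdge e = s(a, b))
        lo (lo + Pi.single 0 (m : ℤ)) := by
      refine reflTransGen_line P lo 0 m fun k hk => hP _ fun t => ?_
      have hk' : (k : ℤ) ≤ m := by exact_mod_cast hk
      have := hg 0
      have := hg 1
      fin_cases t <;> simp <;> omega
    have h2 : ReflTransGen (fun a b => P a ∧ P b ∧ ∃ e ∈ (zdGraph 2).edgeSet, dualEdge e = s(a, b))
        (lo + Pi.single 0 (m : ℤ)) (lo + Pi.single 0 (m : ℤ) + Pi.single 1 (n : ℤ)) := by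
      refine reflTransGen_line P _ 1 n fun k hk => hP _ fun t => ?_
      have hk' : (k : ℤ) ≤ n := by exact_mod_cast hk
      have := hg 0
      have := hg 1
      fin_cases t <;> simp <;> omega
    rw [hmid] at h2
    exact h1.trans h2
  exact (reflTransGen_reverse (faceAdj_symm P) (key f hf)).trans (key f' hf')

/-- **Outer faces escape upwards**: every outer face of `B(M)` is joined through lattice-adjacent
outer faces to a face of height at least `M`. [folklore] -/
theorem exists_high_of_not_isInnerFace (M : ℕ) {g₀ : Site 2} (hg₀ : ¬ IsInnerFace M g₀) :
    ∃ g : Site 2, (M : ℤ) ≤ g 1 ∧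
      ReflTransGen (fun a b => ¬ IsInnerFace M a ∧ ¬ IsInnerFace M b ∧
        ∃ e ∈ (zdGraph 2).edgeSet, dualEdge e = s(a, b)) g₀ g := by
  -- going up inside an outer column
  have hup : ∀ g : Site 2, (g 0 ≤ -(M : ℤ) - 1 ∨ (M : ℤ) ≤ g 0) →
      ∃ g' : Site 2, (M : ℤ) ≤ g' 1 ∧
        ReflTransGen (fun a b => ¬ IsInnerFace M a ∧ ¬ IsInnerFace M b ∧
          ∃ e ∈ (zdGraph 2).edgeSet, dualEdge e = s(a, b)) g g' := by
    intro g hg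
    refine ⟨g + Pi.single 1 ((((M : ℤ) - g 1).toNat : ℕ) : ℤ), ?_, ?_⟩
    · simp; have := Int.self_le_toNat ((M : ℤ) - g 1); omega
    · refine reflTransGen_line _ g 1 _ fun k _ h => ?_
      have := h 0
      simp at this
      omega
  by_cases h0 : g₀ 0 ≤ -(M : ℤ) - 1 ∨ (M : ℤ) ≤ g₀ 0
  · exact hup g₀ h0
  · -- `g₀` is in an inner column, hence above or below the box
    have h1 : g₀ 1 ≤ -(M : ℤ) - 1 ∨ (M : ℤ) ≤ g₀ 1 := by
      by_contra h1
      apply hg₀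
      intro i
      fin_cases i <;> simp <;> omega
    rcases h1 with h1 | h1
    · -- below: move right to the column `M`, then up
      set m : ℕ := ((M : ℤ) - g₀ 0).toNat with hm
      have hm' : (m : ℤ) = M - g₀ 0 := by rw [hm, Int.toNat_of_nonneg (by omega)]
      have hright : ReflTransGen (fun a b => ¬ IsInnerFace M a ∧ ¬ IsInnerFace M b ∧
          ∃ e ∈ (zdGraph 2).edgeSet, dualEdge e = s(a, b)) g₀ (g₀ + Pi.single 0 (m : ℤ)) := by
        refine reflTransGen_line _ g₀ 0 m fun k _ h => ?_
        have := h 1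
        simp at this
        omega
      obtain ⟨g', hg', hp⟩ := hup (g₀ + Pi.single 0 (m : ℤ)) (Or.inr (by simp [hm']))
      exact ⟨g', hg', hright.trans hp⟩
    · exact ⟨g₀, h1, ReflTransGen.refl⟩

/-- **A site of `j + B(ρ)` (`ρ ≥ 1`) is a corner of a face all of whose corners lie in `j + B(ρ)`.**
[folklore] -/
theorem exists_touchesFace_forall_sub_mem_box {j x : Site 2} {ρ : ℕ} (hρ : 1 ≤ ρ)
    (hx : x - j ∈ box 2 ρ) :
    ∃ f : Site 2, TouchesFace x f ∧ ∀ v, TouchesFace v f → v - j ∈ box 2 ρ := by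
  rw [mem_box] at hx
  refine ⟨fun i => if x i - j i = ρ then x i - 1 else x i, fun i => ?_, fun v hv => ?_⟩
  · by_cases h : x i - j i = ρ
    · right; simp [h]
    · left; simp [h]
  · rw [mem_box]
    intro i
    have h1 := le_and_le_of_touchesFace hv i
    have h2 := hx i
    simp only [Pi.sub_apply] at h1 h2 ⊢
    by_cases h : x i - j i = ρ
    · rw [if_pos h] at h1; constructor <;> omega
    · rw [if_neg h] at h1; constructor <;> omega

/-- A face all of whose corners lie in `B(M)` is an inner face. [folklore] -/
theorem isInnerFace_of_forall_touchesFace {M : ℕ} {f : Site 2}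
    (h : ∀ v, TouchesFace v f → v ∈ box 2 M) : IsInnerFace M f := by
  intro i
  have h1 := h f (touchesFace_self f)
  have h2 : TouchesFace (f + 1) f := fun k => Or.inr (by simp)
  have h2' := h (f + 1) h2
  rw [mem_box] at h1 h2'
  have := h1 i
  have := h2' i
  simp at this
  constructor <;> omega

/-- A lattice edge with an inner face of `B(M)` is a lattice edge of `B(M)`. [folklore] -/
theorem mem_boxLatticeEdges_of_isFaceOf {M : ℕ} {e : Sym2 (Site 2)} (he : e ∈ (zdGraph 2).edgeSet)
    {a : Site 2} (ha : IsFaceOf a e) (hin : IsInnerFace M a) : e ∈ boxLatticeEdges M := by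
  rw [mem_boxLatticeEdges]
  refine ⟨?_, he⟩
  induction e using Sym2.ind with
  | h x y =>
    exact mk_mem_boxEdges.2 ⟨mem_box_of_touchesFace hin (touchesFace_of_isFaceOf he ha (Sym2.mem_mk_left _ _)),
      mem_box_of_touchesFace hin (touchesFace_of_isFaceOf he ha (Sym2.mem_mk_right _ _))⟩

/-! ### Terminal data of the exploration -/

section Terminal

variable {M : ℕ} {X : Finset (Sym2 (Site 2))} {ω : BondConfig (Site 2)}

/-- **Hypotheses on the terminal data** of the boundary exploration: examined edges are lattice
edges of the box, every examined edge has an endpoint in `𝒪` and a face in `𝒟`, and no edge is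
eligible (all three hold at time `termTime M`, `BoundaryExplorer.lean`). [folklore] -/
structure IsTerminal (M : ℕ) (X : Finset (Sym2 (Site 2))) (ω : BondConfig (Site 2)) : Prop where
  subset : X ⊆ boxLatticeEdges M
  two_arms : ∀ e ∈ X, (∃ v ∈ e, OReach M X ω v) ∧ ∃ f : Site 2, IsFaceOf f e ∧ DReach M X ω f
  not_eligible : ∀ e, ¬ Eligible M X ω e

/-- The terminal data of the boundary explorer at time `termTime M`. [folklore] -/
theorem isTerminal_termTime (M : ℕ) (ω : BondConfig (Site 2)) :
    IsTerminal M (ProbeHistory.supp ((boundaryExplorer M).hist (termTime M) ω)) ω :=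
  ⟨supp_hist_subset_boxLatticeEdges M ω _, fun _ he => oReach_and_dReach_of_mem_supp_hist M ω _ he,
    not_eligible_termTime M ω⟩

variable (hT : IsTerminal M X ω)
include hT

/-- **Examined open edges have both endpoints in `𝒪`.** [folklore] -/
theorem IsTerminal.oReach_of_mem {e : Sym2 (Site 2)} (heX : e ∈ X) (heω : e ∈ ω) {v : Site 2}
    (hv : v ∈ e) : OReach M X ω v := by
  obtain ⟨⟨u, hu, hO⟩, -⟩ := hT.two_arms e heX
  by_cases huv : u = v
  · exact huv ▸ hO
  · have he : e = s(u, v) := (Sym2.mem_and_mem_iff huv).1 ⟨hu, hv⟩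
    subst he
    exact hO.step heX heω

/-- **Examined closed lattice edges have both faces in `𝒟`.** [folklore] -/
theorem IsTerminal.dReach_of_mem {e : Sym2 (Site 2)} (heX : e ∈ X) (heω : e ∉ ω) {f : Site 2}
    (hf : IsFaceOf f e) : DReach M X ω f := by
  obtain ⟨-, ⟨f₀, hf₀, hD⟩⟩ := hT.two_arms e heX
  have he := (mem_boxLatticeEdges.1 (hT.subset heX)).2
  obtain ⟨g, -, hd⟩ := exists_dualEdge_eq_of_isFaceOf he hf₀
  rcases (isFaceOf_iff_of_dualEdge_eq hd).1 hf with rfl | rfl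
  · exact hD
  · exact hD.step heX heω he hd

/-- **Every site of `𝒪` is a corner of a face of `𝒟`.** [folklore] -/
theorem IsTerminal.exists_touchesFace_dReach {v : Site 2} (hv : OReach M X ω v) :
    ∃ f : Site 2, TouchesFace v f ∧ DReach M X ω f := by
  obtain ⟨s, hs, h⟩ := hv
  induction h with
  | refl =>
    obtain ⟨f, hf, hout⟩ := exists_touchesFace_not_isInnerFace hs
    exact ⟨f, hf, dReach_of_not_isInnerFace X ω hout⟩
  | @tail x y _ hxy _ =>
    obtain ⟨-, ⟨f, hf, hD⟩⟩ := hT.two_arms _ hxy.1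
    have he := (mem_boxLatticeEdges.1 (hT.subset hxy.1)).2
    exact ⟨f, touchesFace_of_isFaceOf he hf (Sym2.mem_mk_right _ _), hD⟩

/-- **Termination, unpacked**: an unexamined lattice edge of the box with an endpoint in `𝒪` has
no face in `𝒟`. [folklore] -/
theorem IsTerminal.not_dReach_of_not_mem {e : Sym2 (Site 2)} (he : e ∈ boxLatticeEdges M) (heX : e ∉ X)
    {v : Site 2} (hv : v ∈ e) (hO : OReach M X ω v) {f : Site 2} (hf : IsFaceOf f e) :
    ¬ DReach M X ω f :=
  fun hD => hT.not_eligible e ⟨he, heX, ⟨v, hv, hO⟩, ⟨f, hf, hD⟩⟩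

/-! ### Components of the non-`𝒟` faces and their separating edges -/

/-- **The component of the face `φ`** among the faces not in `𝒟`, under adjacency across lattice
edges. [folklore] -/
def faceComp (M : ℕ) (X : Finset (Sym2 (Site 2))) (ω : BondConfig (Site 2)) (φ : Site 2) : Set (Site 2) :=
  {f | ReflTransGen (fun a b => ¬ DReach M X ω a ∧ ¬ DReach M X ω b ∧
    ∃ e ∈ (zdGraph 2).edgeSet, dualEdge e = s(a, b)) φ f}

omit hT in
/-- A face is in its own component. [folklore] -/
theorem self_mem_faceComp (φ : Site 2) : φ ∈ faceComp M X ω φ := ReflTransGen.refl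

omit hT in
/-- Faces of the component of a non-`𝒟` face are not in `𝒟`. [folklore] -/
theorem not_dReach_of_mem_faceComp {φ : Site 2} (hφ : ¬ DReach M X ω φ) {f : Site 2}
    (hf : f ∈ faceComp M X ω φ) : ¬ DReach M X ω f := by
  induction hf with
  | refl => exact hφ
  | tail _ hbc _ => exact hbc.2.1

omit hT in
/-- Components are closed under adjacency among non-`𝒟` faces. [folklore] -/
theorem mem_faceComp_of_adj {φ : Site 2} (hφ : ¬ DReach M X ω φ) {f g : Site 2} (hf : f ∈ faceComp M X ω φ)
    (hg : ¬ DReach M X ω g) {e : Sym2 (Site 2)} (he : e ∈ (zdGraph 2).edgeSet)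
    (hd : dualEdge e = s(f, g)) : g ∈ faceComp M X ω φ :=
  ReflTransGen.tail hf ⟨not_dReach_of_mem_faceComp hφ hf, hg, e, he, hd⟩

omit hT in
/-- A component containing a face is that face's component. [folklore] -/
theorem faceComp_eq_of_mem {φ ψ : Site 2} (hψ : ψ ∈ faceComp M X ω φ) : faceComp M X ω φ = faceComp M X ω ψ := by
  ext f
  constructor
  · exact fun hf => (reflTransGen_reverse (faceAdj_symm fun a => ¬ DReach M X ω a) hψ).trans hf
  · exact fun hf => ReflTransGen.trans hψ hf

omit hT in
/-- Faces of a component of a non-`𝒟` face are inner faces (outer faces are in `𝒟`). [folklore] -/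
theorem isInnerFace_of_mem_faceComp {φ : Site 2} (hφ : ¬ DReach M X ω φ) {f : Site 2}
    (hf : f ∈ faceComp M X ω φ) : IsInnerFace M f := by
  by_contra h
  exact not_dReach_of_mem_faceComp hφ hf (dReach_of_not_isInnerFace X ω h)

omit hT in
/-- **The other face of a separating edge is in `𝒟`.** [folklore] -/
theorem dReach_of_separates {φ : Site 2} (hφ : ¬ DReach M X ω φ) {e : Sym2 (Site 2)}
    (he : e ∈ (zdGraph 2).edgeSet) {a b : Site 2} (hd : dualEdge e = s(a, b))
    (ha : a ∈ faceComp M X ω φ) (hb : b ∉ faceComp M X ω φ) : DReach M X ω b := by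
  by_contra h
  exact hb (mem_faceComp_of_adj hφ ha h he hd)

omit hT in
/-- A separating edge is a lattice edge of the box (it has an inner face). [folklore] -/
theorem mem_boxLatticeEdges_of_separates {φ : Site 2} (hφ : ¬ DReach M X ω φ) {e : Sym2 (Site 2)}
    (he : e ∈ (zdGraph 2).edgeSet) (hsep : SeparatesFaces (faceComp M X ω φ) e) :
    e ∈ boxLatticeEdges M := by
  obtain ⟨a, b, hd, ha, -⟩ := hsep
  exact mem_boxLatticeEdges_of_isFaceOf he (isFaceOf_left_of_dualEdge_eq hd)
    (isInnerFace_of_mem_faceComp hφ ha)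

/-- **The type dichotomy of separating edges**: a lattice edge separating the component of a
non-`𝒟` face from its complement is either examined, open, with all endpoints in `𝒪` (type α), or
unexamined with no endpoint in `𝒪` (type β). [folklore] -/
theorem IsTerminal.type_dichotomy {φ : Site 2} (hφ : ¬ DReach M X ω φ) {e : Sym2 (Site 2)}
    (he : e ∈ (zdGraph 2).edgeSet) (hsep : SeparatesFaces (faceComp M X ω φ) e) :
    (e ∈ X ∧ e ∈ ω ∧ ∀ v ∈ e, OReach M X ω v) ∨ (e ∉ X ∧ ∀ v ∈ e, ¬ OReach M X ω v) := by
  have hbox := mem_boxLatticeEdges_of_separates hφ he hsep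
  obtain ⟨a, b, hd, ha, hb⟩ := hsep
  have hDb := dReach_of_separates hφ he hd ha hb
  have hDa := not_dReach_of_mem_faceComp hφ ha
  by_cases heX : e ∈ X
  · left
    have heω : e ∈ ω := by
      by_contra heω
      exact hDa (hT.dReach_of_mem heX heω (isFaceOf_left_of_dualEdge_eq hd))
    exact ⟨heX, heω, fun v hv => hT.oReach_of_mem heX heω hv⟩
  · right
    exact ⟨heX, fun v hv hO => hT.not_dReach_of_not_mem hbox heX hv hO (isFaceOf_right_of_dualEdge_eq hd) hDb⟩

/-- **Uniformity of components**: if some lattice edge separating the component `W` of a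
non-`𝒟` face from its complement is examined, then every such edge is examined, open, with all
endpoints in `𝒪`. (The even, all-or-nothing set of examined separating edges is the whole edge
boundary of `W`, by `mem_of_parity`.) [folklore] -/
theorem IsTerminal.sep_uniform {φ : Site 2} (hφ : ¬ DReach M X ω φ)
    (hα : ∃ e₁ ∈ (zdGraph 2).edgeSet, SeparatesFaces (faceComp M X ω φ) e₁ ∧ e₁ ∈ X)
    {e : Sym2 (Site 2)} (he : e ∈ (zdGraph 2).edgeSet) (hsep : SeparatesFaces (faceComp M X ω φ) e) :
    e ∈ X ∧ e ∈ ω ∧ ∀ v ∈ e, OReach M X ω v := by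
  set W := faceComp M X ω φ with hW
  obtain ⟨e₁, he₁, hsep₁, he₁X⟩ := hα
  -- the set of examined separating edges
  set S : Finset (Sym2 (Site 2)) := (boxLatticeEdges M).filter (fun e => SeparatesFaces W e ∧ e ∈ X) with hS
  have hSE : ∀ e ∈ S, e ∈ (zdGraph 2).edgeSet := fun e he =>
    (mem_boxLatticeEdges.1 (Finset.mem_filter.1 he).1).2
  have hmemS : ∀ {e : Sym2 (Site 2)}, e ∈ (zdGraph 2).edgeSet → SeparatesFaces W e → e ∈ X → e ∈ S :=
    fun he hsep heX => Finset.mem_filter.2 ⟨mem_boxLatticeEdges_of_separates hφ he hsep, hsep, heX⟩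
  -- type α of an examined separating edge
  have hαtype : ∀ {e : Sym2 (Site 2)}, e ∈ (zdGraph 2).edgeSet → SeparatesFaces W e → e ∈ X →
      e ∈ ω ∧ ∀ v ∈ e, OReach M X ω v := by
    intro e he hsep heX
    rcases hT.type_dichotomy hφ he hsep with h | h
    · exact h.2
    · exact absurd heX h.1
  -- heights
  have hheight : ∀ e ∈ S, ∀ x ∈ e, x 1 < (M : ℤ) + 1 := by
    intro e he x hx
    have := (mem_box.1 (mem_box_of_mem_boxLatticeEdges (Finset.mem_filter.1 he).1 hx)) 1
    omega
  -- even degrees: all-or-nothing around a vertex of `𝒪`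
  have heven : ∀ v : Site 2, Even ((S.filter (v ∈ ·)).card) := by
    refine even_degree_of_allOrNothing S W hSE fun v ⟨e₀, he₀, hve₀⟩ e he hve => ?_
    obtain ⟨-, hsep₀, he₀X⟩ := Finset.mem_filter.1 he₀
    have hOv : OReach M X ω v := (hαtype (hSE e₀ he₀) hsep₀ he₀X).2 v hve₀
    constructor
    · exact fun heS => (Finset.mem_filter.1 heS).2.1
    · intro hsep
      refine hmemS he hsep ?_
      rcases hT.type_dichotomy hφ he hsep with h | h
      · exact h.1
      · exact absurd hOv (h.2 v hve)
  -- connectivity of `W` through `S`-free face paths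
  have hconn : ∀ a ∈ W, ∀ b ∈ W,
      ReflTransGen (fun a b => ∃ e ∈ (zdGraph 2).edgeSet, e ∉ S ∧ dualEdge e = s(a, b)) a b := by
    have hsub : ∀ a b : Site 2, (¬ DReach M X ω a ∧ ¬ DReach M X ω b ∧
        ∃ e ∈ (zdGraph 2).edgeSet, dualEdge e = s(a, b)) →
        W a → (∃ e ∈ (zdGraph 2).edgeSet, e ∉ S ∧ dualEdge e = s(a, b)) := by
      rintro a b ⟨-, hb, e, he, hd⟩ ha
      refine ⟨e, he, fun heS => ?_, hd⟩
      obtain ⟨-, ⟨a', b', hd', ha', hb'⟩, -⟩ := Finset.mem_filter.1 heS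
      have hbW : b ∈ W := mem_faceComp_of_adj hφ ha hb he hd
      rw [hd] at hd'
      rcases Sym2.eq_iff.1 hd' with ⟨-, h2⟩ | ⟨h1, -⟩
      · exact hb' (h2 ▸ hbW)
      · exact hb' (h1 ▸ ha)
    -- paths from `φ` inside `W` avoid `S`
    have hpath : ∀ a ∈ W,
        ReflTransGen (fun a b => ∃ e ∈ (zdGraph 2).edgeSet, e ∉ S ∧ dualEdge e = s(a, b)) φ a := by
      intro a ha
      induction ha with
      | refl => exact ReflTransGen.refl
      | tail hab hbc ih => exact ih.tail (hsub _ _ hbc hab)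
    intro a ha b hb
    exact (reflTransGen_reverse (freeAdj_symm S) (hpath a ha)).trans (hpath b hb)
  -- escape of the outside faces of separating edges
  have hesc : ∀ e ∈ (zdGraph 2).edgeSet, ∀ a b : Site 2, dualEdge e = s(a, b) → a ∈ W → b ∉ W →
      ∃ g : Site 2, (M : ℤ) + 1 - 1 ≤ g 1 ∧
        ReflTransGen (fun a b => ∃ e ∈ (zdGraph 2).edgeSet, e ∉ S ∧ dualEdge e = s(a, b)) b g := by
    intro e he a b hd ha hb
    obtain ⟨g₀, hg₀, hpath⟩ := dReach_of_separates hφ he hd ha hb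
    -- the `𝒟`-path from the outer face `g₀` to `b` crosses closed examined edges, none in `S`
    have h1 : ReflTransGen (fun a b => ∃ e ∈ (zdGraph 2).edgeSet, e ∉ S ∧ dualEdge e = s(a, b)) g₀ b := by
      refine reflTransGen_of_imp (fun c d ⟨e', he'X, he'ω, he', hd'⟩ => ⟨e', he', fun he'S => ?_, hd'⟩) hpath
      obtain ⟨-, hsep', -⟩ := Finset.mem_filter.1 he'S
      exact he'ω (hαtype he' hsep' he'X).1
    -- then from `g₀` upwards through outer faces
    obtain ⟨g, hg, hup⟩ := exists_high_of_not_isInnerFace M hg₀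
    have h2 : ReflTransGen (fun a b => ∃ e ∈ (zdGraph 2).edgeSet, e ∉ S ∧ dualEdge e = s(a, b)) g₀ g := by
      refine reflTransGen_of_imp (fun c d ⟨hc, hd', e', he', hdd⟩ => ⟨e', he', fun he'S => ?_, hdd⟩) hup
      obtain ⟨-, ⟨a', b', hda, ha', -⟩, -⟩ := Finset.mem_filter.1 he'S
      have hin := isInnerFace_of_mem_faceComp hφ ha'
      rw [hdd] at hda
      rcases Sym2.eq_iff.1 hda with ⟨h1, -⟩ | ⟨-, h2⟩
      · exact hc (h1 ▸ hin)
      · exact hd' (h2 ▸ hin)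
    exact ⟨g, by omega, (reflTransGen_reverse (freeAdj_symm S) h1).trans h2⟩
  -- the parity lemma
  have heS : e ∈ S := mem_of_parity S W ((M : ℤ) + 1) hSE hheight heven hconn hesc
    (hmemS he₁ hsep₁ he₁X) hsep₁ he hsep
  have heX : e ∈ X := (Finset.mem_filter.1 heS).2.2
  exact ⟨heX, hαtype he hsep heX⟩

/-! ### The invariant along open paths from the sphere -/

/-- **Pure sites**: all four faces cornered at `v` belong to `W`. [folklore] -/
def IsPure (W : Set (Site 2)) (v : Site 2) : Prop := ∀ f, TouchesFace v f → f ∈ W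

omit hT in
/-- A uniform component: every separating lattice edge has all its endpoints in `𝒪`. [folklore] -/
def IsUniform (M : ℕ) (X : Finset (Sym2 (Site 2))) (ω : BondConfig (Site 2)) (φ : Site 2) : Prop :=
  ∀ e ∈ (zdGraph 2).edgeSet, SeparatesFaces (faceComp M X ω φ) e → e ∈ X ∧ e ∈ ω ∧ ∀ v ∈ e, OReach M X ω v

omit hT in
/-- **Pure or explored**: in a uniform component, a site cornering a face of the component is
either in `𝒪` or pure. [folklore] -/
theorem oReach_or_isPure {φ : Site 2} (hU : IsUniform M X ω φ) {v f : Site 2}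
    (hv : TouchesFace v f) (hf : f ∈ faceComp M X ω φ) :
    OReach M X ω v ∨ IsPure (faceComp M X ω φ) v := by
  by_cases hO : OReach M X ω v
  · exact Or.inl hO
  · right
    intro g hg
    by_contra hgW
    obtain ⟨e, he, hve, a, b, hd, ha, hb⟩ := exists_edge_of_touchesFace (P := (· ∈ faceComp M X ω φ)) hv hg hf hgW
    exact hO ((hU e he ⟨a, b, hd, ha, hb⟩).2.2 v hve)

/-- **Leaving `𝒪` through an unexamined edge enters a uniform component.** If `v ∈ 𝒪` and the
open lattice edge `e ∋ v` of the box is not examined, then the faces of `e` are not in `𝒟`,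
and the component of either of them is uniform. [folklore] -/
theorem IsTerminal.isUniform_of_not_mem {v : Site 2} (hO : OReach M X ω v) {e : Sym2 (Site 2)}
    (he : e ∈ boxLatticeEdges M) (heX : e ∉ X) (hve : v ∈ e) {a : Site 2} (ha : IsFaceOf a e) :
    ¬ DReach M X ω a ∧ IsUniform M X ω a := by
  have heE := (mem_boxLatticeEdges.1 he).2
  have hDa : ¬ DReach M X ω a := hT.not_dReach_of_not_mem he heX hve hO ha
  refine ⟨hDa, ?_⟩
  -- a separating edge at `v`: `v` corners `a` and a face of `𝒟`
  obtain ⟨g, hvg, hDg⟩ := hT.exists_touchesFace_dReach hO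
  have hgW : g ∉ faceComp M X ω a := fun h => not_dReach_of_mem_faceComp hDa h hDg
  obtain ⟨e₁, he₁, hve₁, c, d, hd₁, hc, hdW⟩ :=
    exists_edge_of_touchesFace (P := (· ∈ faceComp M X ω a)) (touchesFace_of_isFaceOf heE ha hve) hvg
      (self_mem_faceComp a) hgW
  have hsep₁ : SeparatesFaces (faceComp M X ω a) e₁ := ⟨c, d, hd₁, hc, hdW⟩
  have he₁X : e₁ ∈ X := by
    rcases hT.type_dichotomy hDa he₁ hsep₁ with h | h
    · exact h.1
    · exact absurd hO (h.2 v hve₁)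
  exact fun e' he' hsep' => hT.sep_uniform hDa ⟨e₁, he₁, hsep₁, he₁X⟩ he' hsep'

/-- **The invariant along open paths.** Along a walk of the open graph of `B(M)` (lattice
configuration) starting at a site that is in `𝒪` or pure in a uniform component, every site is in
`𝒪` or pure in a uniform component. [folklore] -/
theorem IsTerminal.inv_of_walk (hω : ω ⊆ (zdGraph 2).edgeSet) {u w : Site 2} (p : (boxOpenGraph ω M).Walk u w)
    (hu : OReach M X ω u ∨ ∃ φ, ¬ DReach M X ω φ ∧ IsUniform M X ω φ ∧ IsPure (faceComp M X ω φ) u) :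
    ∀ v ∈ p.support, OReach M X ω v ∨
      ∃ φ, ¬ DReach M X ω φ ∧ IsUniform M X ω φ ∧ IsPure (faceComp M X ω φ) v := by
  induction p with
  | nil => intro v hv; rw [Walk.support_nil, List.mem_singleton] at hv; exact hv ▸ hu
  | @cons u u' w hadj p ih =>
    -- one step: from `u` to `u'`
    have hstep : OReach M X ω u' ∨
        ∃ φ, ¬ DReach M X ω φ ∧ IsUniform M X ω φ ∧ IsPure (faceComp M X ω φ) u' := by
      obtain ⟨heω, hub, hu'b, hne⟩ := boxOpenGraph_adj.1 hadj
      have heE : s(u, u') ∈ (zdGraph 2).edgeSet := hω heω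
      have hebox : s(u, u') ∈ boxLatticeEdges M :=
        mem_boxLatticeEdges.2 ⟨mk_mem_boxEdges.2 ⟨hub, hu'b⟩, heE⟩
      obtain ⟨a, b, -, hd⟩ := exists_dualEdge_eq_mk heE
      have ha : IsFaceOf a s(u, u') := isFaceOf_left_of_dualEdge_eq hd
      rcases hu with hO | ⟨φ, hφ, hU, hpure⟩
      · by_cases heX : s(u, u') ∈ X
        · exact Or.inl (hT.oReach_of_mem heX heω (Sym2.mem_mk_right _ _))
        · obtain ⟨hDa, hUa⟩ := hT.isUniform_of_not_mem hO hebox heX (Sym2.mem_mk_left _ _) ha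
          rcases oReach_or_isPure hUa (touchesFace_of_isFaceOf heE ha (Sym2.mem_mk_right _ _))
            (self_mem_faceComp a) with h | h
          · exact Or.inl h
          · exact Or.inr ⟨a, hDa, hUa, h⟩
      · have haW : a ∈ faceComp M X ω φ := hpure a (touchesFace_of_isFaceOf heE ha (Sym2.mem_mk_left _ _))
        rcases oReach_or_isPure hU (touchesFace_of_isFaceOf heE ha (Sym2.mem_mk_right _ _)) haW with h | h
        · exact Or.inl h
        · exact Or.inr ⟨φ, hφ, hU, h⟩
    intro v hv
    rw [Walk.support_cons, List.mem_cons] at hv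
    rcases hv with rfl | hv
    · exact hu
    · exact ih hstep v hv

omit hT in
/-- **Exit from a set of faces along a walk**: a walk of the open graph from a non-pure site to a
pure site (for a set of faces `W`) passes through a site cornering both a face of `W` and a face
not in `W`. [folklore] -/
theorem exists_mixed_of_walk (hω : ω ⊆ (zdGraph 2).edgeSet) (W : Set (Site 2)) {u w : Site 2}
    (p : (boxOpenGraph ω M).Walk u w) (hu : ¬ IsPure W u) (hw : IsPure W w) :
    ∃ v ∈ p.support, (∃ f, TouchesFace v f ∧ f ∈ W) ∧ ∃ f, TouchesFace v f ∧ f ∉ W := by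
  induction p with
  | nil => exact absurd hw hu
  | @cons u u' w hadj p ih =>
    by_cases hu' : IsPure W u'
    · -- `u` corners the faces of the edge `{u, u'}`, which are faces of the pure site `u'`
      obtain ⟨heω, -, -, -⟩ := boxOpenGraph_adj.1 hadj
      have heE : s(u, u') ∈ (zdGraph 2).edgeSet := hω heω
      obtain ⟨a, b, -, hd⟩ := exists_dualEdge_eq_mk heE
      have ha : IsFaceOf a s(u, u') := isFaceOf_left_of_dualEdge_eq hd
      have haW : a ∈ W := hu' a (touchesFace_of_isFaceOf heE ha (Sym2.mem_mk_right _ _))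
      have hnp : ∃ f, TouchesFace u f ∧ f ∉ W := by
        by_contra h
        push Not at h
        exact hu fun f hf => h f hf
      exact ⟨u, Walk.start_mem_support _, ⟨a, touchesFace_of_isFaceOf heE ha (Sym2.mem_mk_left _ _), haW⟩, hnp⟩
    · obtain ⟨v, hv, h⟩ := ih hu' hw
      exact ⟨v, by rw [Walk.support_cons]; exact List.mem_cons_of_mem _ hv, h⟩

/-! ### Untouched blocks -/

omit hT in
/-- **Inner faces of an untouched block are not in `𝒟`**: if no lattice edge with both endpoints
in `V = j + B(ρ)` is examined, a face all of whose corners lie in `V` is not in `𝒟` (entering it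
would cross an edge of that face). [folklore] -/
theorem not_dReach_of_forall_touchesFace {j : Site 2} {ρ : ℕ}
    (hV : ∀ x, x - j ∈ box 2 ρ → x ∈ box 2 M)
    (hB : ∀ e ∈ X, ¬ ∀ v ∈ e, v - j ∈ box 2 ρ) {f : Site 2}
    (hf : ∀ v, TouchesFace v f → v - j ∈ box 2 ρ) : ¬ DReach M X ω f := by
  rintro ⟨g, hg, hpath⟩
  have hin : IsInnerFace M f := isInnerFace_of_forall_touchesFace fun v hv => hV v (hf v hv)
  rcases hpath.cases_tail with hfg | ⟨c, -, ⟨e, heX, -, he, hd⟩⟩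
  · exact hg (hfg ▸ hin)
  · exact hB e heX fun v hv => hf v (touchesFace_of_isFaceOf he (isFaceOf_right_of_dualEdge_eq hd) hv)

/-- **A separating edge of the block component near each boundary cluster.** Let `W₀` be the
component of a face `φ₀` with `¬𝒟 φ₀`, and `x` a site cornering a face of `W₀`, joined to a sphere
site by a walk of the open graph. Then `W₀` is uniform and some site reachable from `x` lies on a
lattice edge separating `W₀` from its complement. [folklore] -/
theorem IsTerminal.exists_sep_reachable (hω : ω ⊆ (zdGraph 2).edgeSet) {φ₀ : Site 2}
    (hφ₀ : ¬ DReach M X ω φ₀) {x f : Site 2} (hxf : TouchesFace x f) (hf : f ∈ faceComp M X ω φ₀)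
    {s : Site 2} (hs : s ∈ siteSphere M) (p : (boxOpenGraph ω M).Walk s x) :
    IsUniform M X ω φ₀ ∧ ∃ v : Site 2, (boxOpenGraph ω M).Reachable x v ∧
      ∃ e ∈ (zdGraph 2).edgeSet, v ∈ e ∧ SeparatesFaces (faceComp M X ω φ₀) e := by
  have hOs : OReach M X ω s := oReach_of_mem_siteSphere X ω hs
  have hinv := hT.inv_of_walk hω p (Or.inl hOs) x (Walk.end_mem_support _)
  rcases hinv with hOx | ⟨φ, hφ, hU, hpure⟩
  · -- `x ∈ 𝒪`: `x` corners a `𝒟`-face and the face `f ∈ W₀`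
    obtain ⟨g, hxg, hDg⟩ := hT.exists_touchesFace_dReach hOx
    have hgW : g ∉ faceComp M X ω φ₀ := fun h => not_dReach_of_mem_faceComp hφ₀ h hDg
    obtain ⟨e, he, hxe, a, b, hd, ha, hb⟩ :=
      exists_edge_of_touchesFace (P := (· ∈ faceComp M X ω φ₀)) hxf hxg hf hgW
    have hsep : SeparatesFaces (faceComp M X ω φ₀) e := ⟨a, b, hd, ha, hb⟩
    have heX : e ∈ X := by
      rcases hT.type_dichotomy hφ₀ he hsep with h | h
      · exact h.1
      · exact absurd hOx (h.2 x hxe)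
    exact ⟨fun e' he' hsep' => hT.sep_uniform hφ₀ ⟨e, he, hsep, heX⟩ he' hsep',
      x, Reachable.refl _, e, he, hxe, hsep⟩
  · -- `x` pure in a uniform component, which is `W₀` since `x` corners `f ∈ W₀`
    have hfφ : f ∈ faceComp M X ω φ := hpure f hxf
    have heq : faceComp M X ω φ = faceComp M X ω φ₀ :=
      (faceComp_eq_of_mem hfφ).trans (faceComp_eq_of_mem hf).symm
    rw [heq] at hpure
    have hU₀ : IsUniform M X ω φ₀ := fun e he hsep => hU e he (by rw [heq]; exact hsep)
    refine ⟨hU₀, ?_⟩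
    -- the sphere site `s` is not pure (it corners an outer face), so the walk exits `W₀`
    have hs' : ¬ IsPure (faceComp M X ω φ₀) s := by
      obtain ⟨g, hsg, hout⟩ := exists_touchesFace_not_isInnerFace hs
      exact fun h => hout (isInnerFace_of_mem_faceComp hφ₀ (h g hsg))
    obtain ⟨v, hv, ⟨f₁, hvf₁, hf₁⟩, ⟨f₂, hvf₂, hf₂⟩⟩ := exists_mixed_of_walk hω _ p hs' hpure
    obtain ⟨e, he, hve, a, b, hd, ha, hb⟩ :=
      exists_edge_of_touchesFace (P := (· ∈ faceComp M X ω φ₀)) hvf₁ hvf₂ hf₁ hf₂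
    refine ⟨v, ?_, e, he, hve, a, b, hd, ha, hb⟩
    exact ((p.takeUntil v hv).reachable).symm.trans p.reachable |>.symm

/-- **The pivotal block is examined (contrapositive form).** Let the terminal data of the boundary
exploration of `B(M)` on the lattice configuration `ω` examine no lattice edge with both endpoints
in the block `V = j + B(ρ)` (`ρ ≥ 1`, `V ⊆ B(M)`). Then any two sites of `V` joined to sphere sites
by walks of the open graph of `B(M)` are joined to each other. (vdBN 2020, §5.2: "if `ω ∈ {v_j is
pivotal}`, the state of `v_j` must be explored by `Γ`", block form, bond percolation on `ℤ²`.) [cite: VandenbergNolin2020, §5.2 (a pivotal vertex is explored by Γ)] -/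
theorem IsTerminal.boxOpenGraph_reachable_of_forall_not_mem (hω : ω ⊆ (zdGraph 2).edgeSet)
    {j : Site 2} {ρ : ℕ} (hρ : 1 ≤ ρ) (hV : ∀ x, x - j ∈ box 2 ρ → x ∈ box 2 M)
    (hB : ∀ e ∈ X, ¬ ∀ v ∈ e, v - j ∈ box 2 ρ)
    {x y sx sy : Site 2} (hx : x - j ∈ box 2 ρ) (hy : y - j ∈ box 2 ρ)
    (hsx : sx ∈ siteSphere M) (hsy : sy ∈ siteSphere M)
    (px : (boxOpenGraph ω M).Walk sx x) (py : (boxOpenGraph ω M).Walk sy y) :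
    (boxOpenGraph ω M).Reachable x y := by
  -- the component `W₀` of the inner faces of the block
  obtain ⟨φ₀, hxφ₀, hφ₀V⟩ := exists_touchesFace_forall_sub_mem_box hρ hx
  obtain ⟨φy, hyφy, hφyV⟩ := exists_touchesFace_forall_sub_mem_box hρ hy
  have hnotD : ∀ f : Site 2, (∀ v, TouchesFace v f → v - j ∈ box 2 ρ) → ¬ DReach M X ω f :=
    fun f hf => not_dReach_of_forall_touchesFace hV hB hf
  have hφ₀ : ¬ DReach M X ω φ₀ := hnotD φ₀ hφ₀V
  -- `φy ∈ W₀`: the inner faces of the block form a rectangle of non-`𝒟` faces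
  have hrect : ∀ g : Site 2, (∀ v, TouchesFace v g → v - j ∈ box 2 ρ) ↔
      ∀ i, (j - (ρ : ℤ) • 1) i ≤ g i ∧ g i ≤ (j + ((ρ : ℤ) - 1) • 1) i := by
    intro g
    constructor
    · intro h i
      have h1 := mem_box.1 (h g (touchesFace_self g)) i
      have h2 := mem_box.1 (h (g + 1) fun k => Or.inr (by simp)) i
      simp at h1 h2 ⊢
      constructor <;> omega
    · intro h v hv
      rw [mem_box]
      intro i
      have h1 := h i
      have h2 := le_and_le_of_touchesFace hv i
      simp at h1 ⊢
      constructor <;> omega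
  have hφy : φy ∈ faceComp M X ω φ₀ := by
    refine reflTransGen_of_imp (fun a b ⟨ha, hb, e, he, hd⟩ => ⟨hnotD a ha, hnotD b hb, e, he, hd⟩)
      (reflTransGen_of_mem_rect (fun g => ∀ v, TouchesFace v g → v - j ∈ box 2 ρ) (j - (ρ : ℤ) • 1)
        (j + ((ρ : ℤ) - 1) • 1) (fun g hg => (hrect g).2 hg) ((hrect φ₀).1 hφ₀V) ((hrect φy).1 hφyV))
  -- separating edges near both clusters; uniformity
  obtain ⟨hU, vx, hxvx, ex, hex, hvxex, hsepx⟩ := hT.exists_sep_reachable hω hφ₀ hxφ₀ (self_mem_faceComp φ₀) hsx px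
  obtain ⟨-, vy, hyvy, ey, hey, hvyey, hsepy⟩ := hT.exists_sep_reachable hω hφ₀ hyφy hφy hsy py
  -- the separating edges reachable from `x`
  set W := faceComp M X ω φ₀ with hW
  set S : Finset (Sym2 (Site 2)) :=
    (boxLatticeEdges M).filter (fun e => SeparatesFaces W e ∧ ∀ z ∈ e, (boxOpenGraph ω M).Reachable x z) with hS
  have hSE : ∀ e ∈ S, e ∈ (zdGraph 2).edgeSet := fun e he =>
    (mem_boxLatticeEdges.1 (Finset.mem_filter.1 he).1).2
  -- an endpoint of a separating edge reaches the other endpoint (the edge is open in the box)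
  have hreach_edge : ∀ {e : Sym2 (Site 2)}, e ∈ (zdGraph 2).edgeSet → SeparatesFaces W e →
      ∀ v ∈ e, ∀ z ∈ e, (boxOpenGraph ω M).Reachable v z := by
    intro e he hsep v hv z hz
    obtain ⟨-, heω, -⟩ := hU e he hsep
    have hbox := mem_boxLatticeEdges_of_separates hφ₀ he hsep
    by_cases hvz : v = z
    · exact hvz ▸ Reachable.refl _
    · have heq : e = s(v, z) := (Sym2.mem_and_mem_iff hvz).1 ⟨hv, hz⟩
      subst heq
      exact (boxOpenGraph_adj.2 ⟨heω, mem_box_of_mem_boxLatticeEdges hbox (Sym2.mem_mk_left _ _),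
        mem_box_of_mem_boxLatticeEdges hbox (Sym2.mem_mk_right _ _), hvz⟩).reachable
  have hmemS : ∀ {e : Sym2 (Site 2)}, e ∈ (zdGraph 2).edgeSet → SeparatesFaces W e →
      ∀ v ∈ e, (boxOpenGraph ω M).Reachable x v → e ∈ S := by
    intro e he hsep v hv hxv
    exact Finset.mem_filter.2 ⟨mem_boxLatticeEdges_of_separates hφ₀ he hsep, hsep,
      fun z hz => hxv.trans (hreach_edge he hsep v hv z hz)⟩
  have hheight : ∀ e ∈ S, ∀ x ∈ e, x 1 < (M : ℤ) + 1 := by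
    intro e he z hz
    have := (mem_box.1 (mem_box_of_mem_boxLatticeEdges (Finset.mem_filter.1 he).1 hz)) 1
    omega
  have heven : ∀ v : Site 2, Even ((S.filter (v ∈ ·)).card) := by
    refine even_degree_of_allOrNothing S W hSE fun v ⟨e₀, he₀, hve₀⟩ e he hve => ?_
    obtain ⟨-, -, hr₀⟩ := Finset.mem_filter.1 he₀
    constructor
    · exact fun heS => (Finset.mem_filter.1 heS).2.1
    · exact fun hsep => hmemS he hsep v hve (hr₀ v hve₀)
  have hconn : ∀ a ∈ W, ∀ b ∈ W,
      ReflTransGen (fun a b => ∃ e ∈ (zdGraph 2).edgeSet, e ∉ S ∧ dualEdge e = s(a, b)) a b := by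
    have hsub : ∀ a b : Site 2, (¬ DReach M X ω a ∧ ¬ DReach M X ω b ∧
        ∃ e ∈ (zdGraph 2).edgeSet, dualEdge e = s(a, b)) →
        W a → (∃ e ∈ (zdGraph 2).edgeSet, e ∉ S ∧ dualEdge e = s(a, b)) := by
      rintro a b ⟨-, hb, e, he, hd⟩ ha
      refine ⟨e, he, fun heS => ?_, hd⟩
      obtain ⟨-, ⟨a', b', hd', ha', hb'⟩, -⟩ := Finset.mem_filter.1 heS
      have hbW : b ∈ W := mem_faceComp_of_adj hφ₀ ha hb he hd
      rw [hd] at hd'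
      rcases Sym2.eq_iff.1 hd' with ⟨-, h2⟩ | ⟨h1, -⟩
      · exact hb' (h2 ▸ hbW)
      · exact hb' (h1 ▸ ha)
    have hpath : ∀ a ∈ W,
        ReflTransGen (fun a b => ∃ e ∈ (zdGraph 2).edgeSet, e ∉ S ∧ dualEdge e = s(a, b)) φ₀ a := by
      intro a ha
      induction ha with
      | refl => exact ReflTransGen.refl
      | tail hab hbc ih => exact ih.tail (hsub _ _ hbc hab)
    intro a ha b hb
    exact (reflTransGen_reverse (freeAdj_symm S) (hpath a ha)).trans (hpath b hb)
  have hesc : ∀ e ∈ (zdGraph 2).edgeSet, ∀ a b : Site 2, dualEdge e = s(a, b) → a ∈ W → b ∉ W →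
      ∃ g : Site 2, (M : ℤ) + 1 - 1 ≤ g 1 ∧
        ReflTransGen (fun a b => ∃ e ∈ (zdGraph 2).edgeSet, e ∉ S ∧ dualEdge e = s(a, b)) b g := by
    intro e he a b hd ha hb
    obtain ⟨g₀, hg₀, hpath⟩ := dReach_of_separates hφ₀ he hd ha hb
    have h1 : ReflTransGen (fun a b => ∃ e ∈ (zdGraph 2).edgeSet, e ∉ S ∧ dualEdge e = s(a, b)) g₀ b := by
      refine reflTransGen_of_imp (fun c d ⟨e', he'X, he'ω, he', hd'⟩ => ⟨e', he', fun he'S => ?_, hd'⟩) hpath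
      obtain ⟨-, hsep', -⟩ := Finset.mem_filter.1 he'S
      exact he'ω (hU e' he' hsep').2.1
    obtain ⟨g, hg, hup⟩ := exists_high_of_not_isInnerFace M hg₀
    have h2 : ReflTransGen (fun a b => ∃ e ∈ (zdGraph 2).edgeSet, e ∉ S ∧ dualEdge e = s(a, b)) g₀ g := by
      refine reflTransGen_of_imp (fun c d ⟨hc, hd', e', he', hdd⟩ => ⟨e', he', fun he'S => ?_, hdd⟩) hup
      obtain ⟨-, ⟨a', b', hda, ha', -⟩, -⟩ := Finset.mem_filter.1 he'S
      have hin := isInnerFace_of_mem_faceComp hφ₀ ha'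
      rw [hdd] at hda
      rcases Sym2.eq_iff.1 hda with ⟨h1, -⟩ | ⟨-, h2⟩
      · exact hc (h1 ▸ hin)
      · exact hd' (h2 ▸ hin)
    exact ⟨g, by omega, (reflTransGen_reverse (freeAdj_symm S) h1).trans h2⟩
  -- parity: `ey ∈ S`, i.e. `vy` is reachable from `x`
  have heyS : ey ∈ S := mem_of_parity S W ((M : ℤ) + 1) hSE hheight heven hconn hesc
    (hmemS hex hsepx vx hvxex hxvx) hsepx hey hsepy
  obtain ⟨-, -, hr⟩ := Finset.mem_filter.1 heyS
  exact (hr vy hvyey).trans hyvy.symm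

end Terminal

end Literature.Probability.Percolation
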